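import Summits.QuantumFields.BalabanUV.Beta.FP.SliceProjectorMidInv
import Summits.QuantumFields.BalabanUV.Beta.FP.CoarseCovarianceStripAliasWeights

/-!
# `BalabanUV.Beta.FP.SliceProjectorEntries` — road «FP» (binder row D1), organisation γ, row GAMMA-3 (b): **THE ALIAS ENTRIES OF THE
# SLICE CO-PROJECTOR `1 − Π = Δ⁻¹Q′ᵀ Mid⁻¹ Q′Δ⁻¹` IN POLE-FREE FORM** — `A_{ll′}(p) = (q_l·e_l)·(q̄_{l′}·e_{l′}) / 𝒩(p)` with
# `e_0 = 1`, `e_l = Δ^ξ(p)/Δ^ξ(p+2πl)` (`l ≠ 0`): the honest entries `(q_l/Δ_l)(q̄_{l′}/Δ_{l′})/Yfac` off the zero set of `Δ^ξ` (the «l = 0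
# cancellation»), n-UNIFORMLY BOUNDED and HOLOMORPHIC on the strip `Strip D κ_Y`, every `n ≥ 1`

HONEST FRAMING (cell contract, verbatim): «discharging `BetaPertH` makes Bałaban's UV stability UNCONDITIONAL — a real constructive-QFT
result; it is NOT the continuum limit and NOT the Clay problem.»  HONEST DEPENDENCY (verbatim): «continuum YM on T⁴ ⇐ BetaPertH ∧ nine
spine estimates (0/9 proved); BetaPertH ⇐ (D1) ∧ (D4) ∧ CAP+tail; G-an2-4 gates asym, D1 and NE2/3/4.»  THIS MODULE DISCHARGES NOTHING of
D1 ∕ BetaPertH: [folklore] assembly over part (a) `SliceProjectorMidInv` (`yInv`, `Ncal_lower`, `Ncal_ne_zero`), the tree's B4∕B5 strip modules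
(`U`, `DeltaXi`, `shift`, `norm_DeltaXi_le`, `norm_DeltaXi_shift_ge`, `differentiableAt_DeltaXi(_shift)`, `dAt_div`, `dAt_finset_prod`) and
ne9-leaf-04-g35's `CoarseCovarianceStripAliasWeights` (`gsum_alias_mul_gsum_neg`, `alias_hyp_of_mem_fat`, `norm_gsum_aliasPt_le`, `aliasPt_apply'`)
BY NAME.  [our object] data defs `qa`, `qb`, `ew`, `Aent` + one CONSTANT def `CA3` (dimension only); no `def … : Prop`; nothing is cited; 0 sorry.
NOT summit progress; NOT hbook, NOT D1, NOT BetaPertH, NOT continuum, NOT Clay.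

ABSOLUTE RULE (cell, verbatim): «No internally-minted statement may enter as a cited fact. Every hypothesis is either kernel-proved in this
package or a verbatim quotation of a PUBLISHED theorem with page reference. The manuscript(s) under audit are NOT citable for their own
disputed steps — they are the thing under adjudication; programme-internal (2001/route/tribunal) claims are never citable.»

WHY (GAMMA-DESIGN §3: `(1−Π)(k)_{ll′} = [q′(k_l)/Δ(k_l)]·Mid(k)⁻¹·[q̄′(k_{l′})/Δ(k_{l′})]`, «the l = 0 singularities CANCEL»).  With `Δ(k_l) = Δ^ξ(k+2πl)/n²`,
`Mid = n^{·}·Yfac` and part (a)'s `yInv = (Δ^ξ)²/𝒩 = 1/Yfac`: `A_{ll′} = (q_l/Δ^ξ_l)(q̄_{l′}/Δ^ξ_{l′})·(Δ^ξ_0)²/𝒩`, and distributing one `Δ^ξ_0` to each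
factor removes every `1/Δ^ξ_0` (`e_0 = 1`).  The remaining denominators `Δ^ξ_l`, `l ≠ 0`, have modulus `≥ 2` on the fat strip and `𝒩` is bounded below
there (part (a)), so every entry is holomorphic and `O(1)` uniformly in `n`.  The FINE kernel of `1 − Π` is `n^{−D}·latticeKernel_k[Σ_{ll′} φ_l(a,k)·
A_{ll′}(k)·φ̄_{l′}(b,k)](X − Y)` at `x = nX + a`, `y = nY + b` (entire bounded phases `φ`) — its assembly, `2π`-periodicity by alias re-indexing and
the decay `≤ C·n^{−D}·e^{−κ|x−y|∞/n}` are part (c) (next file of the row).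

CONTENT (`D = d+1`; strip `Strip D (kapY D)`, `kapY ≤ rOf`, so strip points are fat points of radius `rOf D ≤ 1/4`).
* §1 [our object] `qa`, `qb` (the two «square roots» `n^{−D}Π_i gsum(±(k_l)_i)`), `qa_mul_qb` (`= U n l p` on the fat region), `gsum`∕`qa`∕`qb` bounds,
  `ew` (`e_l`), `norm_ew_le`, **`Aent`**, the dictionary **`Aent_eq_honest`** (off the zero set: `A_{ll′} = (qa_l/Δ^ξ_l)(qb_{l′}/Δ^ξ_{l′})·yInv`).
* §2 **`norm_Aent_le`** (`‖A_{ll′}‖ ≤ CA3` on the strip, every `n ≥ 1`, every `l, l′`).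
* §3 holomorphy: `differentiableAt_qa`∕`_qb`∕`_ew`, **`differentiableAt_Aent`** (jointly, at every strip point).
Unit `b2b-balaban-beta-d1-formalise-leaf-06` (gen 8), organisation γ (owner ruling R-FP-25), row GAMMA-3 (b); part (a) = p244337.
-/

noncomputable section

namespace Summit.QuantumFields.BalabanUV.Beta.FP.SliceProjectorEntries

open Complex Set Finset
open scoped BigOperators Real
open Literature.MathematicalPhysics.QuantumFieldTheory.Balaban1983to89
open B4Strip (Strip ofRealVec reVec DeltaXi U Sxi uFactor shift shift_zero)
open B4StripCauchy (Fat strip_subset_fat norm_DeltaXi_le norm_DeltaXi_shift_ge rOf rOf_pos rOf_le d_mul_rOf_sq_le)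
open B5Strip145 (Ncal)
open B5Strip145Analytic (Yfac differentiableAt_DeltaXi differentiableAt_DeltaXi_shift dAt_div dAt_finset_prod kappa_small)
open Summit.QuantumFields.BalabanUV.Beta.GAN24.FibreSymbols (gsum)
open Summit.QuantumFields.BalabanUV.Beta.GAN24.AliasDecimate (aliasPt)
open Summit.QuantumFields.BalabanUV.Beta.FP.CoarseCovarianceStripAliasWeights (gsum_alias_mul_gsum_neg alias_hyp_of_mem_fat
  norm_gsum_aliasPt_le norm_gsum_neg_aliasPt_le aliasPt_apply')
open Summit.QuantumFields.BalabanUV.Beta.FP.SliceProjectorMidInv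

variable {d : ℕ}

/-! ## §1 The objects -/

/-- [our object] the alias «square root» `qa n l p := n^{−D}·Π_i gsum((k_l)_i) n` (the block-AVERAGE symbol at the alias momentum `k_l = (p + 2πl)/n`). -/
def qa (n : ℕ) (l : Fin (d + 1) → Fin n) (p : Fin (d + 1) → ℂ) : ℂ := ((n : ℂ) ^ (d + 1))⁻¹ * ∏ i, gsum (aliasPt n l p i) n

/-- [our object] the reflected «square root» `qb n l p := n^{−D}·Π_i gsum(−(k_l)_i) n`. -/
def qb (n : ℕ) (l : Fin (d + 1) → Fin n) (p : Fin (d + 1) → ℂ) : ℂ := ((n : ℂ) ^ (d + 1))⁻¹ * ∏ i, gsum (-(aliasPt n l p i)) n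

/-- [folklore] **`qa·qb = U n l p` ON THE FAT REGION** (`r ≤ 1/4`): the product of the two square roots is B4's continued weight `|u(p+2πl)|²`. -/
theorem qa_mul_qb (n : ℕ) [NeZero n] {r : ℝ} (hr : r ≤ 1 / 4) {p : Fin (d + 1) → ℂ} (hp : p ∈ Fat (d + 1) r) (l : Fin (d + 1) → Fin n) :
    qa n l p * qb n l p = U n l p := by
  have hn : (n : ℂ) ≠ 0 := Nat.cast_ne_zero.mpr (NeZero.ne n)
  have hprod : ∏ i, (gsum (aliasPt n l p i) n * gsum (-(aliasPt n l p i)) n) = (n : ℂ) ^ (2 * (d + 1)) * U n l p := by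
    calc ∏ i, (gsum (aliasPt n l p i) n * gsum (-(aliasPt n l p i)) n) = ∏ i, ((n : ℂ) ^ 2 * uFactor n (l i : ℕ) (p i)) :=
          Finset.prod_congr rfl fun i _ => by
            rw [aliasPt_apply']
            exact gsum_alias_mul_gsum_neg (NeZero.ne n) (l i : ℕ) (p i) (alias_hyp_of_mem_fat hr hp l i)
      _ = (n : ℂ) ^ (2 * (d + 1)) * U n l p := by
          rw [Finset.prod_mul_distrib, Finset.prod_const, Finset.card_univ, Fintype.card_fin, ← pow_mul, U]
  calc qa n l p * qb n l p = (((n : ℂ) ^ (d + 1))⁻¹ * ((n : ℂ) ^ (d + 1))⁻¹) * ∏ i, (gsum (aliasPt n l p i) n * gsum (-(aliasPt n l p i)) n) := by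
        rw [qa, qb, Finset.prod_mul_distrib]; ring
    _ = U n l p := by rw [hprod]; field_simp; ring

/-- [folklore] `‖qa n l p‖ ≤ e^{Dκ}` when `|Im p_i| ≤ κ` for all `i`. -/
theorem norm_qa_le (n : ℕ) [NeZero n] {κ : ℝ} {p : Fin (d + 1) → ℂ} (hp : ∀ i, |(p i).im| ≤ κ) (l : Fin (d + 1) → Fin n) :
    ‖qa n l p‖ ≤ Real.exp (((d : ℝ) + 1) * κ) := by
  have hn : (0 : ℝ) < n := by exact_mod_cast Nat.pos_of_ne_zero (NeZero.ne n)
  rw [qa, norm_mul, norm_inv, norm_pow, Complex.norm_natCast, norm_prod]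
  have h1 : ∏ i, ‖gsum (aliasPt n l p i) n‖ ≤ ∏ _i : Fin (d + 1), ((n : ℝ) * Real.exp κ) :=
    Finset.prod_le_prod (fun i _ => norm_nonneg _) fun i _ => norm_gsum_aliasPt_le l (hp i)
  rw [Finset.prod_const, Finset.card_univ, Fintype.card_fin] at h1
  calc ((n : ℝ) ^ (d + 1))⁻¹ * ∏ i, ‖gsum (aliasPt n l p i) n‖ ≤ ((n : ℝ) ^ (d + 1))⁻¹ * ((n : ℝ) * Real.exp κ) ^ (d + 1) :=
        mul_le_mul_of_nonneg_left h1 (by positivity)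
    _ = Real.exp κ ^ (d + 1) := by rw [mul_pow]; field_simp
    _ = Real.exp (((d : ℝ) + 1) * κ) := by rw [← Real.exp_nat_mul]; push_cast; ring_nf

/-- [folklore] `‖qb n l p‖ ≤ e^{Dκ}` when `|Im p_i| ≤ κ` for all `i`. -/
theorem norm_qb_le (n : ℕ) [NeZero n] {κ : ℝ} {p : Fin (d + 1) → ℂ} (hp : ∀ i, |(p i).im| ≤ κ) (l : Fin (d + 1) → Fin n) :
    ‖qb n l p‖ ≤ Real.exp (((d : ℝ) + 1) * κ) := by
  have hn : (0 : ℝ) < n := by exact_mod_cast Nat.pos_of_ne_zero (NeZero.ne n)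
  rw [qb, norm_mul, norm_inv, norm_pow, Complex.norm_natCast, norm_prod]
  have h1 : ∏ i, ‖gsum (-(aliasPt n l p i)) n‖ ≤ ∏ _i : Fin (d + 1), ((n : ℝ) * Real.exp κ) :=
    Finset.prod_le_prod (fun i _ => norm_nonneg _) fun i _ => norm_gsum_neg_aliasPt_le l (hp i)
  rw [Finset.prod_const, Finset.card_univ, Fintype.card_fin] at h1
  calc ((n : ℝ) ^ (d + 1))⁻¹ * ∏ i, ‖gsum (-(aliasPt n l p i)) n‖ ≤ ((n : ℝ) ^ (d + 1))⁻¹ * ((n : ℝ) * Real.exp κ) ^ (d + 1) :=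
        mul_le_mul_of_nonneg_left h1 (by positivity)
    _ = Real.exp κ ^ (d + 1) := by rw [mul_pow]; field_simp
    _ = Real.exp (((d : ℝ) + 1) * κ) := by rw [← Real.exp_nat_mul]; push_cast; ring_nf

/-- [our object] the regrouping factor `e_l`: `e_0 = 1`, `e_l = Δ^ξ(p)/Δ^ξ(p + 2πl)` for `l ≠ 0`. -/
def ew (n : ℕ) [NeZero n] (l : Fin (d + 1) → Fin n) (p : Fin (d + 1) → ℂ) : ℂ :=
  if l = fun _ => 0 then 1 else DeltaXi n 0 p / DeltaXi n 0 (shift n l p)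

/-- [folklore] `e_0 = 1`. -/
theorem ew_zero (n : ℕ) [NeZero n] (p : Fin (d + 1) → ℂ) : ew n (fun _ => (0 : Fin n)) p = 1 := by simp [ew]

/-- [folklore] `e_l = Δ^ξ(p)/Δ^ξ(p+2πl)` for `l ≠ 0`. -/
theorem ew_ne (n : ℕ) [NeZero n] {l : Fin (d + 1) → Fin n} (hl : l ≠ fun _ => 0) (p : Fin (d + 1) → ℂ) :
    ew n l p = DeltaXi n 0 p / DeltaXi n 0 (shift n l p) := by simp [ew, hl]

/-- [folklore] `e_l/Δ^ξ(p) = 1/Δ^ξ(p + 2πl)` off the zero set (both cases). -/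
theorem ew_div_DeltaXi (n : ℕ) [NeZero n] (l : Fin (d + 1) → Fin n) {p : Fin (d + 1) → ℂ} (h0 : DeltaXi n 0 p ≠ 0) :
    ew n l p / DeltaXi n 0 p = (DeltaXi n 0 (shift n l p))⁻¹ := by
  by_cases hl : l = fun _ => 0
  · subst hl; rw [ew_zero, shift_zero, one_div]
  · rw [ew_ne n hl]; field_simp

/-- [folklore] **`‖e_l‖ ≤ 8D` ON THE FAT REGION `Fat D (rOf D)`** (`‖Δ^ξ‖ ≤ 16D`, `‖Δ^ξ(· + 2πl)‖ ≥ 2` for `l ≠ 0`); `1 ≤ 8D` covers `l = 0`. -/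
theorem norm_ew_le (n : ℕ) [NeZero n] {p : Fin (d + 1) → ℂ} (hp : p ∈ Fat (d + 1) (rOf (d + 1))) (l : Fin (d + 1) → Fin n) :
    ‖ew n l p‖ ≤ 8 * ((d : ℝ) + 1) := by
  have hn : 1 ≤ n := Nat.one_le_iff_ne_zero.mpr (NeZero.ne n)
  by_cases hl : l = fun _ => 0
  · subst hl; rw [ew_zero, norm_one]
    have : (0 : ℝ) ≤ d := Nat.cast_nonneg d
    linarith
  · rw [ew_ne n hl, norm_div]
    have h1 : ‖DeltaXi n 0 p‖ ≤ 16 * ((d : ℝ) + 1) := by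
      have h := norm_DeltaXi_le n hn 0 le_rfl (rOf_le (d + 1)) hp
      push_cast at h; linarith
    have h2 : 2 ≤ ‖DeltaXi n 0 (shift n l p)‖ :=
      norm_DeltaXi_shift_ge n 0 le_rfl (rOf_le (d + 1)) (by exact_mod_cast d_mul_rOf_sq_le (d + 1)) hp l hl
    rw [div_le_iff₀ (by linarith)]
    nlinarith

/-- [our object] **THE POLE-FREE ALIAS ENTRY OF `1 − Π`**: `Aent n l l′ p := (qa_l·e_l)·(qb_{l′}·e_{l′}) / 𝒩(p)`. -/
def Aent (n : ℕ) [NeZero n] (l l' : Fin (d + 1) → Fin n) (p : Fin (d + 1) → ℂ) : ℂ :=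
  (qa n l p * ew n l p) * (qb n l' p * ew n l' p) / Ncal n p

/-- [our object] **THE DICTIONARY («l = 0 cancellation displayed»)**: off the zero set of `Δ^ξ(p)`,
`A_{ll′} = (qa_l/Δ^ξ(p+2πl))·(qb_{l′}/Δ^ξ(p+2πl′))·yInv n p` — the honest `(q_l/Δ_l)(q̄_{l′}/Δ_{l′})·Mid⁻¹` up to the `n`-power currency. -/
theorem Aent_eq_honest (n : ℕ) [NeZero n] (l l' : Fin (d + 1) → Fin n) {p : Fin (d + 1) → ℂ} (h0 : DeltaXi n 0 p ≠ 0) :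
    Aent n l l' p = (qa n l p / DeltaXi n 0 (shift n l p)) * (qb n l' p / DeltaXi n 0 (shift n l' p)) * yInv n p := by
  rw [Aent, yInv, div_eq_mul_inv (qa n l p), div_eq_mul_inv (qb n l' p), ← ew_div_DeltaXi n l h0, ← ew_div_DeltaXi n l' h0]
  by_cases hN : Ncal n p = 0
  · simp [hN]
  · field_simp

/-! ## §2 The n-uniform bound on the strip -/

/-- [our object] the entry constant `CA3 := (e^{D·rOf D}·8D)²·(2/(4/π²)^D)` (dimension only). -/
def CA3 (d : ℕ) : ℝ := (Real.exp (((d : ℝ) + 1) * rOf (d + 1)) * (8 * ((d : ℝ) + 1))) ^ 2 * (2 / (4 / Real.pi ^ 2) ^ (d + 1))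

/-- [folklore] `0 ≤ CA3`. -/
theorem CA3_nonneg (d : ℕ) : 0 ≤ CA3 d := by unfold CA3; positivity

/-- [folklore] a strip point is a fat point and has small imaginary parts. -/
theorem strip_facts {p : Fin (d + 1) → ℂ} (hp : p ∈ Strip (d + 1) (kapY (d + 1))) :
    p ∈ Fat (d + 1) (rOf (d + 1)) ∧ ∀ i, |(p i).im| ≤ rOf (d + 1) :=
  ⟨strip_subset_fat (rOf_pos _).le (kapY_le_rOf _) hp, fun i => (hp i).2.trans (kapY_le_rOf _)⟩

/-- [our object] **`‖A_{ll′}(p)‖ ≤ CA3` ON THE STRIP `Strip D κ_Y`**, every `n ≥ 1`, every pair of alias indices. -/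
theorem norm_Aent_le (n : ℕ) [NeZero n] {p : Fin (d + 1) → ℂ} (hp : p ∈ Strip (d + 1) (kapY (d + 1))) (l l' : Fin (d + 1) → Fin n) :
    ‖Aent n l l' p‖ ≤ CA3 d := by
  obtain ⟨hfat, him⟩ := strip_facts hp
  set M : ℝ := Real.exp (((d : ℝ) + 1) * rOf (d + 1)) * (8 * ((d : ℝ) + 1)) with hM
  have hM0 : 0 ≤ M := by positivity
  have ha : ‖qa n l p * ew n l p‖ ≤ M := by
    rw [norm_mul]; exact mul_le_mul (norm_qa_le n him l) (norm_ew_le n hfat l) (norm_nonneg _) (by positivity)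
  have hb : ‖qb n l' p * ew n l' p‖ ≤ M := by
    rw [norm_mul]; exact mul_le_mul (norm_qb_le n him l') (norm_ew_le n hfat l') (norm_nonneg _) (by positivity)
  have hN := Ncal_lower n p hp
  have hc : (0 : ℝ) < (4 / Real.pi ^ 2) ^ (d + 1) / 2 := by positivity
  rw [Aent, norm_div, norm_mul, div_le_iff₀ (lt_of_lt_of_le hc hN), CA3]
  calc ‖qa n l p * ew n l p‖ * ‖qb n l' p * ew n l' p‖ ≤ M * M := mul_le_mul ha hb (norm_nonneg _) hM0
    _ = M ^ 2 * (2 / (4 / Real.pi ^ 2) ^ (d + 1)) * ((4 / Real.pi ^ 2) ^ (d + 1) / 2) := by field_simp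
    _ ≤ M ^ 2 * (2 / (4 / Real.pi ^ 2) ^ (d + 1)) * ‖Ncal n p‖ := mul_le_mul_of_nonneg_left hN (by positivity)

/-! ## §3 Holomorphy on the strip -/

/-- [folklore] each alias coordinate is an entire (affine) function of the coarse momentum. -/
theorem differentiableAt_aliasPt_apply (n : ℕ) (l : Fin (d + 1) → Fin n) (i : Fin (d + 1)) (p : Fin (d + 1) → ℂ) :
    DifferentiableAt ℂ (fun q : Fin (d + 1) → ℂ => aliasPt n l q i) p := by
  have e : (fun q : Fin (d + 1) → ℂ => aliasPt n l q i) = fun q => (q i + 2 * Real.pi * ((l i : ℕ) : ℂ)) * ((n : ℂ))⁻¹ := by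
    funext q; rw [aliasPt_apply', div_eq_mul_inv]
  have h : DifferentiableAt ℂ (fun q : Fin (d + 1) → ℂ => q i) p := differentiableAt_pi.1 differentiableAt_id i
  rw [e]
  exact (h.add_const _).mul_const _

/-- [folklore] `gsum` is entire. -/
theorem differentiableAt_gsum (n : ℕ) (z : ℂ) : DifferentiableAt ℂ (fun w : ℂ => gsum w n) z := by
  unfold gsum
  exact DifferentiableAt.fun_sum fun t _ => ((differentiableAt_id.const_mul I).mul_const (t : ℂ)).cexp

/-- [folklore] `qa n l` is entire. -/
theorem differentiableAt_qa (n : ℕ) (l : Fin (d + 1) → Fin n) (p : Fin (d + 1) → ℂ) : DifferentiableAt ℂ (qa n l) p := by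
  unfold qa
  refine DifferentiableAt.const_mul ?_ _
  exact dAt_finset_prod _ (fun i q => gsum (aliasPt n l q i) n) p fun i _ =>
    (differentiableAt_gsum n _).comp p (differentiableAt_aliasPt_apply n l i p)

/-- [folklore] `qb n l` is entire. -/
theorem differentiableAt_qb (n : ℕ) (l : Fin (d + 1) → Fin n) (p : Fin (d + 1) → ℂ) : DifferentiableAt ℂ (qb n l) p := by
  unfold qb
  refine DifferentiableAt.const_mul ?_ _
  exact dAt_finset_prod _ (fun i q => gsum (-(aliasPt n l q i)) n) p fun i _ =>
    (differentiableAt_gsum n _).comp p (differentiableAt_aliasPt_apply n l i p).neg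

/-- [folklore] `e_l` is holomorphic at every fat point (`Δ^ξ(· + 2πl) ≠ 0` there for `l ≠ 0`). -/
theorem differentiableAt_ew (n : ℕ) [NeZero n] (l : Fin (d + 1) → Fin n) {p : Fin (d + 1) → ℂ} (hp : p ∈ Fat (d + 1) (rOf (d + 1))) :
    DifferentiableAt ℂ (ew n l) p := by
  by_cases hl : l = fun _ => 0
  · subst hl
    have e : ew n (fun _ => (0 : Fin n)) = fun _ : Fin (d + 1) → ℂ => (1 : ℂ) := funext fun q => ew_zero n q
    rw [e]; exact differentiableAt_const _
  · have e : ew n l = fun q => DeltaXi n 0 q / DeltaXi n 0 (shift n l q) := funext fun q => ew_ne n hl q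
    rw [e]
    have hne : DeltaXi n 0 (shift n l p) ≠ 0 := by
      intro h
      have h2 := norm_DeltaXi_shift_ge n 0 le_rfl (rOf_le (d + 1)) (by exact_mod_cast d_mul_rOf_sq_le (d + 1)) hp l hl
      rw [h, norm_zero] at h2; linarith
    exact dAt_div (differentiableAt_DeltaXi n 0 p) (differentiableAt_DeltaXi_shift n 0 l p) hne

/-- [our object] **EVERY ENTRY `A_{ll′}` IS HOLOMORPHIC (JOINTLY) AT EVERY POINT OF THE STRIP `Strip D κ_Y`.** -/
theorem differentiableAt_Aent (n : ℕ) [NeZero n] (l l' : Fin (d + 1) → Fin n) {p : Fin (d + 1) → ℂ} (hp : p ∈ Strip (d + 1) (kapY (d + 1))) :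
    DifferentiableAt ℂ (Aent n l l') p := by
  obtain ⟨hfat, _⟩ := strip_facts hp
  have h1 : DifferentiableAt ℂ (fun q => (qa n l q * ew n l q) * (qb n l' q * ew n l' q)) p :=
    ((differentiableAt_qa n l p).mul (differentiableAt_ew n l hfat)).mul ((differentiableAt_qb n l' p).mul (differentiableAt_ew n l' hfat))
  have h2 : DifferentiableAt ℂ (Ncal n) p :=
    B5Strip145Analytic.differentiableAt_Ncal n (rOf_le _) (d_mul_rOf_sq_le _) hfat
  show DifferentiableAt ℂ (fun q => (qa n l q * ew n l q) * (qb n l' q * ew n l' q) / Ncal n q) p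
  exact dAt_div h1 h2 (Ncal_ne_zero n hp)

end Summit.QuantumFields.BalabanUV.Beta.FP.SliceProjectorEntries

end
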